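import Literature.NumberTheory.Sieve.RoughNumbersBuchstabIdentity
import Literature.NumberTheory.LFunctions.PrimeSumStandardWeights
import HarnessLib

/-!
# Rough numbers in residue classes: Buchstab's identity with weights and the Buchstab step

Topic `Literature/NumberTheory/Sieve`. Everything here is PROVED (no definitions, no named facts).
For the `N`-rough numbers `roughIcc N X = {1 ≤ b ≤ X : p ∣ b ⇒ p ≥ N}`
(`SmoothRoughDecomposition.lean`), a modulus `q ≥ 1` and the class counts
`Φ(x, y; q, c) = #((roughIcc ⌈y⌉₊ ⌊x⌋₊).filter (· ≡ c [MOD q]))`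
`= #{1 ≤ m ≤ x : m ≡ c (mod q), p ∣ m ⇒ p ≥ y}` we record (sub-namespace `RoughAP`):

* `sum_roughIcc_eq_sum_add_sum` — **Buchstab's identity with an arbitrary weight** `F`: for
  `N ≤ M`, `∑_{b ∈ roughIcc N X} F(b) = ∑_{b ∈ roughIcc M X} F(b) + ∑_{N ≤ p < M} ∑_{c ∈ roughIcc p (X/p)} F(p c)`
  (sorting by the least prime factor; the weight-free case is `card_roughIcc_eq_card_add_sum` of
  `RoughNumbersBuchstabIdentity.lean`, whose bijection `b ↦ b / p` is reused verbatim), and its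
  counting form `card_filter_roughIcc_eq_add_sum` for an arbitrary predicate;
* `exists_coprime_mul_modEq_iff` — for `(p, q) = (c, q) = 1` the condition `p m ≡ c (mod q)` is a
  reduced class `m ≡ d (mod q)`;
* `card_roughIcc_eq_sum_card_filter` — for `N > q` every `N`-rough number is prime to `q`, so
  `#roughIcc N X = ∑_{c mod q, (c,q)=1} #{b ∈ roughIcc N X : b ≡ c (mod q)}`;
* `abs_card_filter_sub_le_step_of` — **the Buchstab step for differences of class counts**: if
  `|Φ(X, Y; q, c) − Φ(X, Y; q, c')| ≤ ε₁ X/log Y` is known for `log X ≤ n log Y` (`X ≥ X₀`), then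
  for `y < z = x^{1/n}` Buchstab's identity
  `Φ(x, y; q, c) = Φ(x, z; q, c) + ∑_{y ≤ p < z} Φ(x/p, p; q, p⁻¹c)` and `∑_{y ≤ p < z} 1/p = O(1)`
  (`sum_primes_Ioc_inv_le`, `PrimeSumStandardWeights.lean`) give
  `|Φ(x, y; q, c) − Φ(x, y; q, c')| ≤ ε₁ (4 + 8C₀) x/log y` (all inequalities between the
  parameters supplied as hypotheses, as in `abs_card_roughIcc_sub_main_step_of`).

These are the combinatorial inputs of the equidistribution of rough numbers among the reduced
classes, `RoughNumbersClassesEquidistribution.lean`.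

## References

* G. Tenenbaum, *Introduction to analytic and probabilistic number theory*, 3rd ed., AMS GSM 163
  (2015), Ch. III.6 (Buchstab's identity, the function `Φ(x, y)`). [Tenenbaum2015]
* G. Harman, *Prime-Detecting Sieves*, LMS Monographs 33 (2007), §1.4 (1.4.13).
* H. L. Montgomery, R. C. Vaughan, *Multiplicative Number Theory I*, CUP 2007, §2.1, Thm 2.7
  (Mertens). [MontgomeryVaughan2007]
-/

open Finset Filter
open scoped Chebyshev Topology

noncomputable section

namespace Literature.NumberTheory.Sieve

namespace RoughAP

/-! ### Buchstab's identity with weights -/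

/-- The fibre of the least-prime-factor map over a prime `p ∈ [N, M)`, weighted form: `b ↦ b / p`
is a bijection from `{b ∈ roughIcc N X ∖ roughIcc M X : minFac b = p}` onto `roughIcc p (X / p)`
with inverse `c ↦ p c`, so `∑_{b in the fibre} F(b) = ∑_{c ∈ roughIcc p (X/p)} F(p c)`
(the proof of `card_filter_minFac_eq` with `Finset.sum_bij'`). [folklore] -/
theorem sum_filter_minFac_eq {M₀ : Type*} [AddCommMonoid M₀] (F : ℕ → M₀) {N M X p : ℕ}
    (hp : p.Prime) (hNp : N ≤ p) (hpM : p < M) :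
    ∑ b ∈ (roughIcc N X \ roughIcc M X).filter (fun b => b.minFac = p), F b =
      ∑ c ∈ roughIcc p (X / p), F (p * c) := by
  refine Finset.sum_bij' (fun b _ => b / p) (fun c _ => p * c) ?_ ?_ ?_ ?_ ?_
  · -- `b / p ∈ roughIcc p (X / p)`
    intro b hb
    rw [mem_filter] at hb
    obtain ⟨hbs, hbm⟩ := hb
    have hbN := (mem_sdiff.mp hbs).1
    rw [mem_roughIcc] at hbN ⊢
    have hpb : p ∣ b := hbm ▸ Nat.minFac_dvd b
    refine ⟨⟨?_, Nat.div_le_div_right hbN.1.2⟩, fun r hr hrc => ?_⟩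
    · exact Nat.div_pos (Nat.le_of_dvd hbN.1.1 hpb) hp.pos
    · have hrb : r ∣ b := hrc.trans (Nat.div_dvd_of_dvd hpb)
      exact hbm ▸ Nat.minFac_le_of_dvd hr.two_le hrb
  · -- `p * c` lies in the fibre
    intro c hc
    rw [mem_roughIcc] at hc
    obtain ⟨⟨hc1, hcX⟩, hcr⟩ := hc
    have hpc_fac : ∀ r : ℕ, r.Prime → r ∣ p * c → p ≤ r := by
      intro r hr hrpc
      rcases (Nat.Prime.dvd_mul hr).mp hrpc with h | h
      · exact ((Nat.prime_dvd_prime_iff_eq hr hp).mp h).ge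
      · exact hcr r hr h
    have hmin : (p * c).minFac = p := by
      apply le_antisymm
      · exact Nat.minFac_le_of_dvd hp.two_le (dvd_mul_right p c)
      · have h1 : p * c ≠ 1 := by
          intro h; exact hp.one_lt.ne' (Nat.eq_one_of_mul_eq_one_right h)
        exact hpc_fac _ (Nat.minFac_prime h1) (Nat.minFac_dvd _)
    rw [Finset.mem_filter, Finset.mem_sdiff, mem_roughIcc, mem_roughIcc]
    refine ⟨⟨⟨⟨?_, ?_⟩, fun r hr hrpc => hNp.trans (hpc_fac r hr hrpc)⟩, ?_⟩, hmin⟩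
    · exact Nat.mul_pos hp.pos hc1
    · exact (Nat.mul_le_mul_left p hcX).trans (Nat.mul_div_le X p)
    · rintro ⟨-, hM⟩
      exact (hM p hp (dvd_mul_right p c)).not_gt hpM
  · -- left inverse
    intro b hb
    rw [mem_filter] at hb
    have hpb : p ∣ b := hb.2 ▸ Nat.minFac_dvd b
    exact Nat.mul_div_cancel' hpb
  · -- right inverse
    intro c _
    exact Nat.mul_div_cancel_left c hp.pos
  · -- the weights agree
    intro b hb
    rw [mem_filter] at hb
    have hpb : p ∣ b := hb.2 ▸ Nat.minFac_dvd b
    rw [Nat.mul_div_cancel' hpb]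

/-- **Buchstab's identity with weights** (sorting by the least prime factor): for `N ≤ M` and any
`F`, `∑_{b ∈ roughIcc N X} F(b) = ∑_{b ∈ roughIcc M X} F(b) + ∑_{p prime, N ≤ p < M} ∑_{c ∈ roughIcc p (X/p)} F(p c)`
(Tenenbaum Ch. III.6; Harman (1.4.13) with weights; the case `F = 1` is
`card_roughIcc_eq_card_add_sum`). [folklore] -/
theorem sum_roughIcc_eq_sum_add_sum {M₀ : Type*} [AddCommMonoid M₀] (F : ℕ → M₀) {N M : ℕ}
    (hNM : N ≤ M) (X : ℕ) :
    ∑ b ∈ roughIcc N X, F b =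
      ∑ b ∈ roughIcc M X, F b +
        ∑ p ∈ (Ico N M).filter Nat.Prime, ∑ c ∈ roughIcc p (X / p), F (p * c) := by
  have hsub := roughIcc_subset_of_le hNM X
  rw [← Finset.sum_sdiff hsub, add_comm]
  congr 1
  rw [← Finset.sum_fiberwise_of_maps_to (g := Nat.minFac) (t := (Ico N M).filter Nat.Prime)
    (s := roughIcc N X \ roughIcc M X) ?_ F]
  · refine sum_congr rfl fun p hp => ?_
    rw [mem_filter, mem_Ico] at hp
    exact sum_filter_minFac_eq F hp.2 hp.1.1 hp.1.2
  · intro b hb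
    obtain ⟨-, hpr, hN, hM⟩ := minFac_mem_of_mem_sdiff hb
    exact mem_filter.mpr ⟨mem_Ico.mpr ⟨hN, hM⟩, hpr⟩

/-- **Buchstab's identity for the rough numbers satisfying a predicate** `P`: for `N ≤ M`,
`#{b ∈ roughIcc N X : P b} = #{b ∈ roughIcc M X : P b} + ∑_{p prime, N ≤ p < M} #{c ∈ roughIcc p (X/p) : P (p c)}`.
[folklore] -/
theorem card_filter_roughIcc_eq_add_sum {N M : ℕ} (hNM : N ≤ M) (X : ℕ) (P : ℕ → Prop)
    [DecidablePred P] :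
    #((roughIcc N X).filter P) =
      #((roughIcc M X).filter P) +
        ∑ p ∈ (Ico N M).filter Nat.Prime, #((roughIcc p (X / p)).filter (fun c => P (p * c))) := by
  simp only [card_filter]
  exact sum_roughIcc_eq_sum_add_sum (fun b => if P b then 1 else 0) hNM X

/-! ### Residue classes -/

/-- **Transport of a reduced class through a unit.** If `(p, q) = (c, q) = 1` (`q ≥ 1`) there is a
reduced class `d` with `p m ≡ c (mod q) ↔ m ≡ d (mod q)` for all `m` (`d = p⁻¹ c`). [folklore] -/
theorem exists_coprime_mul_modEq_iff {q p c : ℕ} (hq : 0 < q) (hp : p.Coprime q)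
    (hc : c.Coprime q) : ∃ d : ℕ, d.Coprime q ∧ ∀ m : ℕ, p * m ≡ c [MOD q] ↔ m ≡ d [MOD q] := by
  rcases Nat.lt_or_ge 1 q with hq1 | hq1
  · obtain ⟨e, -, he⟩ := Nat.exists_mul_mod_eq_one_of_coprime hp hq1
    have hpe : p * e ≡ 1 [MOD q] := by
      rw [Nat.ModEq, he, Nat.mod_eq_of_lt hq1]
    have hpd : p * (e * c) ≡ c [MOD q] := by
      simpa [mul_assoc] using hpe.mul_right c
    refine ⟨e * c, ?_, fun m => ⟨fun h => ?_, fun h => ?_⟩⟩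
    · have h1 : (p * (e * c)).Coprime q := by
        rw [Nat.Coprime, hpd.gcd_eq]
        exact hc
      exact Nat.Coprime.coprime_mul_left h1
    · exact Nat.ModEq.cancel_left_of_coprime (Nat.Coprime.gcd_eq_one hp.symm) (h.trans hpd.symm)
    · exact (h.mul_left p).trans hpd
  · have hq' : q = 1 := le_antisymm hq1 hq
    subst hq'
    exact ⟨0, Nat.coprime_one_right 0, fun m => ⟨fun _ => Nat.modEq_one, fun _ => Nat.modEq_one⟩⟩

/-- For `N > q ≥ 1`, every element of `roughIcc N X` is prime to `q` (its prime factors are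
`≥ N > q`). [folklore] -/
theorem coprime_of_mem_roughIcc {q N X b : ℕ} (hq : 0 < q) (hqN : q < N) (hb : b ∈ roughIcc N X) :
    b.Coprime q := by
  rw [mem_roughIcc] at hb
  refine Nat.coprime_of_dvd fun k hk hkb hkq => ?_
  have h1 : N ≤ k := hb.2 k hk hkb
  have h2 : k ≤ q := Nat.le_of_dvd hq hkq
  omega

/-- `(c mod q, q) = 1` iff `(c, q) = 1`. [folklore] -/
theorem coprime_mod_iff {q : ℕ} (c : ℕ) : (c % q).Coprime q ↔ c.Coprime q := by
  rw [Nat.Coprime, Nat.Coprime, ← Nat.gcd_rec, Nat.gcd_comm]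

/-- **Splitting the rough numbers into the reduced classes**: for `N > q ≥ 1`,
`#roughIcc N X = ∑_{c < q, (q, c) = 1} #{b ∈ roughIcc N X : b ≡ c (mod q)}` (the index set is the
one defining `Nat.totient q`). [folklore] -/
theorem card_roughIcc_eq_sum_card_filter {q : ℕ} (hq : 0 < q) {N : ℕ} (hqN : q < N) (X : ℕ) :
    #(roughIcc N X) =
      ∑ c ∈ (range q).filter (Nat.Coprime q), #((roughIcc N X).filter (· ≡ c [MOD q])) := by
  rw [card_eq_sum_card_fiberwise (f := fun b => b % q) (t := (range q).filter (Nat.Coprime q))]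
  · refine sum_congr rfl fun c hc => ?_
    rw [mem_filter, mem_range] at hc
    congr 1
    refine filter_congr fun b _ => ?_
    rw [Nat.ModEq, Nat.mod_eq_of_lt hc.1]
  · intro b hb
    simp only [Finset.mem_coe] at hb ⊢
    rw [Finset.mem_filter, Finset.mem_range]
    refine ⟨Nat.mod_lt b hq, ?_⟩
    exact ((coprime_mod_iff b).mpr (coprime_of_mem_roughIcc hq hqN hb)).symm

/-- The reduced classes below `q` number `φ(q)`. [folklore] -/
theorem card_range_filter_coprime (q : ℕ) : #((range q).filter (Nat.Coprime q)) = q.totient := rfl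

/-! ### The Buchstab step for differences of class counts -/

/-- **Assembly of the inductive step** (all elementary inequalities between the parameters
`y < z = x^{1/n}`, `a = ⌈y⌉ − 1`, `b = ⌈z⌉ − 1` supplied as hypotheses; see
`abs_card_filter_sub_le_step` for the self-contained statement).  Buchstab's identity for the class
counts (`RoughAP.card_filter_roughIcc_eq_add_sum`) gives
`Φ(x, y; q, c) = Φ(x, z; q, c) + ∑_{y ≤ p < z} Φ(x/p, p; q, d_p)` with `p d_p ≡ c (mod q)`
(`RoughAP.exists_coprime_mul_modEq_iff`, `p > q`); the hypothesis bounds the differences at `(x, z)`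
and at every `(x/p, p)` by `ε₁ x/log y` resp. `ε₁ x/(p log y)`, and
`∑_{y ≤ p < z} 1/p ≤ 3(1 + 2C₀) + 2C₀` (`sum_primes_Ioc_inv_le`). [folklore] -/
theorem abs_card_filter_sub_le_step_of {q : ℕ} (hq : 0 < q) {n : ℕ} {ε₁ X₀ C₀ : ℝ}
    (hε₁ : 0 ≤ ε₁) (hC₀ : 0 ≤ C₀) (hE : ∀ t : ℝ, 2 ≤ t → |θ t - t| ≤ C₀ * t / Real.log t ^ 2)
    (hX₀ : ∀ X Y : ℝ, X₀ ≤ X → 2 ≤ Y → Y ≤ X →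
      Real.log X ≤ n * Real.log Y → (q : ℝ) < Y → ∀ c c' : ℕ, c.Coprime q → c'.Coprime q →
        |(#((roughIcc ⌈Y⌉₊ ⌊X⌋₊).filter (· ≡ c [MOD q])) : ℝ) -
            #((roughIcc ⌈Y⌉₊ ⌊X⌋₊).filter (· ≡ c' [MOD q]))| ≤ ε₁ * X / Real.log Y)
    {X Y z a b : ℝ} {N M : ℕ} (hNdef : ⌈Y⌉₊ = N) (hMdef : ⌈z⌉₊ = M) (hNM : N ≤ M)
    (hS : (Finset.Ico N M).filter Nat.Prime = (Finset.Ioc ⌊a⌋₊ ⌊b⌋₊).filter Nat.Prime)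
    (hx0 : 0 < X) (hXX₀ : X₀ ≤ X) (hX₀z : X₀ * z ≤ X) (hY2 : 2 ≤ Y) (hqY : (q : ℝ) < Y)
    (hz2 : 2 ≤ z) (hzx : z ≤ X) (hzz : z * z ≤ X) (hyz : Y < z)
    (hxz : Real.log X ≤ n * Real.log z) (hXY : Real.log X ≤ (n + 1) * Real.log Y)
    (hea : Real.exp 1 ≤ a) (hab : a ≤ b) (hlb : Real.log b ≤ 3 * Real.log a)
    (hpS : ∀ p ∈ (Finset.Ioc ⌊a⌋₊ ⌊b⌋₊).filter Nat.Prime, p.Prime ∧ Y ≤ (p : ℝ) ∧ (p : ℝ) < z)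
    {c c' : ℕ} (hc : c.Coprime q) (hc' : c'.Coprime q) :
    |(#((roughIcc ⌈Y⌉₊ ⌊X⌋₊).filter (· ≡ c [MOD q])) : ℝ) -
        #((roughIcc ⌈Y⌉₊ ⌊X⌋₊).filter (· ≡ c' [MOD q]))| ≤
      ε₁ * (1 + ((1 + 2 * C₀) * 3 + 2 * C₀)) * X / Real.log Y := by
  have hy0 : 0 < Y := by linarith
  have hly : 0 < Real.log Y := Real.log_pos (by linarith)
  have hz0 : 0 < z := by linarith
  have hlz : Real.log Y < Real.log z := Real.log_lt_log hy0 hyz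
  have ha0 : 0 < a := (Real.exp_pos 1).trans_le hea
  have hla : 1 ≤ Real.log a := by rw [Real.le_log_iff_exp_le ha0]; exact hea
  set S := (Finset.Ioc ⌊a⌋₊ ⌊b⌋₊).filter Nat.Prime with hS_def
  -- Buchstab's identity for the two classes
  set XX := ⌊X⌋₊ with hXX
  have hBc := card_filter_roughIcc_eq_add_sum hNM XX (· ≡ c [MOD q])
  have hBc' := card_filter_roughIcc_eq_add_sum hNM XX (· ≡ c' [MOD q])
  rw [hS] at hBc hBc'
  have hmain : (#((roughIcc N XX).filter (· ≡ c [MOD q])) : ℝ) -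
      #((roughIcc N XX).filter (· ≡ c' [MOD q])) =
      ((#((roughIcc M XX).filter (· ≡ c [MOD q])) : ℝ) -
        #((roughIcc M XX).filter (· ≡ c' [MOD q]))) +
      ∑ p ∈ S, ((#((roughIcc p (XX / p)).filter (fun m => p * m ≡ c [MOD q])) : ℝ) -
        #((roughIcc p (XX / p)).filter (fun m => p * m ≡ c' [MOD q]))) := by
    rw [hBc, hBc', Finset.sum_sub_distrib]
    push_cast
    ring
  -- the term at `(X, z)`
  set U : ℝ := ε₁ * X / Real.log Y with hU
  have hU0 : 0 ≤ U := by positivity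
  have hA : |(#((roughIcc M XX).filter (· ≡ c [MOD q])) : ℝ) -
      #((roughIcc M XX).filter (· ≡ c' [MOD q]))| ≤ U := by
    have h := hX₀ X z hXX₀ hz2 hzx hxz (hqY.trans hyz) c c' hc hc'
    rw [hMdef] at h
    refine h.trans ?_
    rw [hU, mul_div_assoc, mul_div_assoc]
    exact mul_le_mul_of_nonneg_left (div_le_div_of_nonneg_left hx0.le hly hlz.le) hε₁
  -- the terms at `(X / p, p)`
  have hterm : ∀ p ∈ S,
      |((#((roughIcc p (XX / p)).filter (fun m => p * m ≡ c [MOD q])) : ℝ) -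
        #((roughIcc p (XX / p)).filter (fun m => p * m ≡ c' [MOD q])))| ≤ U * (p : ℝ)⁻¹ := by
    intro p hp
    obtain ⟨hpP, hYp, hpz⟩ := hpS p hp
    have hp2 : (2 : ℝ) ≤ p := by exact_mod_cast hpP.two_le
    have hp0 : (0 : ℝ) < p := by linarith
    have hqp : (q : ℝ) < p := hqY.trans_le hYp
    have hpq : p.Coprime q := Nat.coprime_of_lt_prime hq.ne' (by exact_mod_cast hqp) hpP
    obtain ⟨d, hd, hiff⟩ := exists_coprime_mul_modEq_iff hq hpq hc
    obtain ⟨d', hd', hiff'⟩ := exists_coprime_mul_modEq_iff hq hpq hc'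
    have hfc : (roughIcc p (XX / p)).filter (fun m => p * m ≡ c [MOD q]) =
        (roughIcc ⌈(p : ℝ)⌉₊ ⌊X / p⌋₊).filter (· ≡ d [MOD q]) := by
      rw [Nat.ceil_natCast, Nat.floor_div_natCast]
      exact Finset.filter_congr fun m _ => hiff m
    have hfc' : (roughIcc p (XX / p)).filter (fun m => p * m ≡ c' [MOD q]) =
        (roughIcc ⌈(p : ℝ)⌉₊ ⌊X / p⌋₊).filter (· ≡ d' [MOD q]) := by
      rw [Nat.ceil_natCast, Nat.floor_div_natCast]
      exact Finset.filter_congr fun m _ => hiff' m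
    have hpp : (p : ℝ) ≤ X / p := by
      rw [le_div_iff₀ hp0]
      exact le_trans (mul_le_mul hpz.le hpz.le hp0.le hz0.le) hzz
    have hXp : X₀ ≤ X / p := by
      calc X₀ ≤ X / z := by rw [le_div_iff₀ hz0]; exact hX₀z
        _ ≤ X / p := div_le_div_of_nonneg_left hx0.le hp0 hpz.le
    have hlyp : Real.log Y ≤ Real.log p := Real.log_le_log hy0 hYp
    have hlogp : 0 < Real.log p := hly.trans_le hlyp
    have hlogXp : Real.log (X / p) ≤ n * Real.log p := by
      rw [Real.log_div hx0.ne' hp0.ne']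
      have h2 : Real.log X ≤ (n + 1) * Real.log p := hXY.trans (by gcongr)
      linarith
    have h := hX₀ (X / p) p hXp hp2 hpp hlogXp hqp d d' hd hd'
    rw [← hfc, ← hfc'] at h
    refine h.trans ?_
    calc ε₁ * (X / p) / Real.log p = ε₁ * X / Real.log p * (p : ℝ)⁻¹ := by
          field_simp
      _ ≤ ε₁ * X / Real.log Y * (p : ℝ)⁻¹ := by gcongr
  -- `∑_{Y ≤ p < z} 1/p ≤ K₀`
  have hsumK : ∑ p ∈ S, (p : ℝ)⁻¹ ≤ (1 + 2 * C₀) * 3 + 2 * C₀ := by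
    have hratio : Real.log b / Real.log a ≤ 3 := by rw [div_le_iff₀ (by linarith)]; exact hlb
    calc ∑ p ∈ S, (p : ℝ)⁻¹ ≤ (1 + 2 * C₀) * (Real.log b / Real.log a) + 2 * C₀ :=
          Literature.NumberTheory.LFunctions.sum_primes_Ioc_inv_le hea hab hC₀ hE
      _ ≤ (1 + 2 * C₀) * 3 + 2 * C₀ := by gcongr
  -- assembly
  rw [hNdef, hmain]
  calc _ ≤ |(#((roughIcc M XX).filter (· ≡ c [MOD q])) : ℝ) -
          #((roughIcc M XX).filter (· ≡ c' [MOD q]))| +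
        |∑ p ∈ S, ((#((roughIcc p (XX / p)).filter (fun m => p * m ≡ c [MOD q])) : ℝ) -
          #((roughIcc p (XX / p)).filter (fun m => p * m ≡ c' [MOD q])))| := abs_add_le _ _
    _ ≤ U + ∑ p ∈ S, U * (p : ℝ)⁻¹ :=
        add_le_add hA ((Finset.abs_sum_le_sum_abs _ _).trans (Finset.sum_le_sum hterm))
    _ = U * (1 + ∑ p ∈ S, (p : ℝ)⁻¹) := by rw [← Finset.mul_sum]; ring
    _ ≤ U * (1 + ((1 + 2 * C₀) * 3 + 2 * C₀)) := by gcongr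
    _ = ε₁ * (1 + ((1 + 2 * C₀) * 3 + 2 * C₀)) * X / Real.log Y := by rw [hU]; ring

end RoughAP

end Literature.NumberTheory.Sieve
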